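import Summits.ResolutionOfSingularities.ResolutionOfSingularities.Theorems.FrobeniusLadderFInjectiveMacaulayficationCIClassRow
import Summits.ResolutionOfSingularities.ResolutionOfSingularities.Theorems.FrobeniusLadderFInjectiveMacaulayficationF108ConsumableHolds
import Summits.ResolutionOfSingularities.ResolutionOfSingularities.Theorems.FrobeniusLadderFInjectiveMacaulayficationFHalfRowOfToricCoverData
import HarnessLib

/-!
# (A4b) ★★★ THE CI CLASS ROW FOR EQUAL-SUPPORT TUPLES, UNCONDITIONALLY, ANY FIELD: the toric data of ✓ `F108Consumable_holds` for ONE convenient member serve the whole tuple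
# (crux `FInjectiveMacaulayfication` stmt-ResolutionOfSingularities-15315, chain w45a; res-L1-w45a-plan-1 RULING R23.3 (A4) «DESK OBSERVATION: for an EQUAL-SUPPORT CI pair Σ_{F₁} = Σ_{F₂},
# so a Σ_{F₁} ∧ Σ(𝔪)-refining consumable cover is exactly what ✓p687854 `F108Consumable_holds` already delivers — check whether the CI row can consume `F108Consumable` verbatim»
# — it can; seat res-L1-w45a-stub-2 g12)

[OURS · L1 W4.5a] Support file (`--supports stmt-ResolutionOfSingularities-15315 --as helper`); def-free; UNCONDITIONAL; no named fact, no sorry; NOT a statement of any manuscript;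
replaces the role of NO printed item. Nothing of the crux is proved. AI-written (AI review weaker than expert review).

* §1 `exists_theta_of_support_eq` — if `θ_V F = Y^e·g` with `g(0) ≠ 0` (unimodular `V`) and `supp F′ = supp F`, then `θ_V F′ = Y^e·g′` with `g′(0) ≠ 0`: the vertex of `F` minimising
  every row weight (✓`NewtonChartLemma.exists_v_eq` / `le_v_of_mem_support`) is a common minimiser for `F′` (✓`exists_theta_eq_monomial_mul_of_commonMinimiser`).
* §2 ★★★ `fHalfRow_CI_of_convenient_equalSupport` — `k` ANY field of characteristic `p`, `K ⊇ k` algebraically closed; `F₀..F_{r−1} ∈ k[X]` (`n ≥ 1`) with a COMMON SUPPORT, one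
  member CONVENIENT, generating a PRIME ideal, GEOMETRICALLY CI-Newton-non-degenerate, `x̄ᵢ ≠ 0`, `X = V(F)` regular off the origin `v`: for EVERY blowing up of `Spec 𝒪_{X,v}` along the
  POINT FLOOR there is `𝓚 ≠ ⊥` supported over the closed point all of whose blowings up are FULL at every stalk — UNCONDITIONAL (tables from ✓`F108ClassRow.F108Consumable_holds k n F_{l₀}`).
  The diagonal Brieskorn–Pham complete intersections `(Σ xᵢ^{aᵢ}, Σ cᵢxᵢ^{aᵢ}, …)` are the intended members (certificate file (A5) separate).
[cite: IshiiSingularities2018, Thm. 4.4.23 and Cor. 4.4.25] [cite: CuetoPopescupampuStepanov2023, Def. 4.2] [cite: StacksProject, Tag 080A]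
-/

-- single-problem summit: the doubled namespace component is forced
set_option linter.dupNamespace false

noncomputable section

open AlgebraicGeometry CategoryTheory Literature.AlgebraicGeometry.Resolution TopologicalSpace IsLocalRing MvPolynomial

namespace Summit.ResolutionOfSingularities.ResolutionOfSingularities.Theorems.FInjectiveMacaulayfication.CIClassRowEqualSupport

open Summit.ResolutionOfSingularities.ResolutionOfSingularities.Theorems.FInjectiveMacaulayfication
open Literature.AlgebraicGeometry.Resolution.BoubakriGreuelMarkwig CINondegenerate SliceableCentre

/-! ## §1 Equal supports share refining charts -/

/-- **EQUAL SUPPORTS SHARE REFINING CHARTS**: if `θ_V F = Y^e·g`, `g(0) ≠ 0` (`V` unimodular) and `supp F′ = supp F`, then `θ_V F′ = Y^e·g′` with `g′(0) ≠ 0`. [folklore] -/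
theorem exists_theta_of_support_eq {k : Type} [Field k] {m : ℕ} (V : Matrix (Fin m) (Fin m) ℕ) (hV : IsUnit (V.map (Nat.cast : ℕ → ℤ)).det)
    (F F' : MvPolynomial (Fin m) k) (hsupp : F'.support = F.support) (e : Fin m →₀ ℕ) (g : MvPolynomial (Fin m) k)
    (hθ : aeval (fun j : Fin m => ∏ i : Fin m, (X i : MvPolynomial (Fin m) k) ^ V i j) F = monomial e 1 * g) (hg0 : constantCoeff g ≠ 0) :
    ∃ g' : MvPolynomial (Fin m) k, aeval (fun j : Fin m => ∏ i : Fin m, (X i : MvPolynomial (Fin m) k) ^ V i j) F' = monomial e 1 * g' ∧ constantCoeff g' ≠ 0 := by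
  classical
  set v : (Fin m →₀ ℕ) → (Fin m →₀ ℕ) := fun α => Finsupp.equivFunOnFinite.symm fun i => ∑ j, V i j * α j with hvdef
  have hv : ∀ α i, v α i = ∑ j, V i j * α j := fun α i => by simp [hvdef]
  obtain ⟨α₀, hα₀, hvα₀⟩ := NewtonChartLemma.exists_v_eq V hV F v hv e g hθ hg0
  have hle := NewtonChartLemma.le_v_of_mem_support V hV F v hv e g hθ
  have hmin : ∀ i : Fin m, ∀ u ∈ F'.support, ∑ j, V i j * α₀ j ≤ ∑ j, V i j * u j := by
    intro i u hu
    rw [hsupp] at hu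
    have h := hle u hu i
    rw [← hvα₀, hv, hv] at h
    exact h
  have hα₀' : α₀ ∈ F'.support := by rw [hsupp]; exact hα₀
  obtain ⟨g', hθ', hg0'⟩ := NewtonChartLemma.exists_theta_eq_monomial_mul_of_commonMinimiser V hV F' α₀ hα₀' hmin
  have he : (Finsupp.equivFunOnFinite.symm (V.mulVec ⇑α₀) : Fin m →₀ ℕ) = e := by
    rw [← hvα₀]
    ext i
    simp [hv, Matrix.mulVec, dotProduct]
  rw [he] at hθ'
  exact ⟨g', hθ', hg0'⟩

/-! ## §2 ★★★ The CI class row for equal-support tuples, unconditionally -/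

set_option maxHeartbeats 800000 in
-- unpacking the interface + one `choose`
/-- ★★★ **THE CI CLASS ROW FOR EQUAL-SUPPORT TUPLES, ANY FIELD OF CHARACTERISTIC `p`, UNCONDITIONAL.** See the module docstring. Tables from ✓`F108ClassRow.F108Consumable_holds k n (Fs l₀)`;
per-chart strict transforms of the other members by §1; then (A4) ✓`CIClassRow.fHalfRow_CI_of_tables`. [OURS · class theorem, unconditional; cite: IshiiSingularities2018, Thm. 4.4.23;
CuetoPopescupampuStepanov2023, Def. 4.2; StacksProject, Tag 080A] -/
theorem fHalfRow_CI_of_convenient_equalSupport (p : ℕ) [Fact p.Prime] (k : Type) [Field k] [CharP k p] (K : Type) [Field K] [Algebra k K] [IsAlgClosed K]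
    {n r : ℕ} (hn : 0 < n) (Fs : Fin r → MvPolynomial (Fin n) k) (hprime : (Ideal.span (Set.range Fs)).IsPrime)
    (l₀ : Fin r) (hconv : ∀ j : Fin n, ∃ N : ℕ, 0 < N ∧ MvPolynomial.coeff (Finsupp.single j N) (Fs l₀) ≠ 0)
    (hsupp : ∀ l : Fin r, (Fs l).support = (Fs l₀).support)
    (hND : ∀ w : Fin n → ℝ, (∀ i, 0 < w i) →
      IsCINondegenerateAlong w (fun l => ((map (algebraMap k K) (Fs l) : MvPolynomial (Fin n) K) : MvPowerSeries (Fin n) K)))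
    (hXne : ∀ v : Fin n, Ideal.Quotient.mk (Ideal.span (Set.range Fs)) (X v) ≠ 0)
    (hreg : ∀ x : Spec (.of (MvPolynomial (Fin n) k ⧸ Ideal.span (Set.range Fs))),
      ¬ Ideal.span (Set.range fun j : Fin n => Ideal.Quotient.mk (Ideal.span (Set.range Fs)) (X j)) ≤ x.asIdeal → IsRegularLocalRing (Localization.AtPrime x.asIdeal))
    (v : Spec (.of (MvPolynomial (Fin n) k ⧸ Ideal.span (Set.range Fs))))
    (hvm : v.asIdeal = Ideal.span (Set.range fun j : Fin n => Ideal.Quotient.mk (Ideal.span (Set.range Fs)) (X j))) :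
    ∀ (S' : Scheme.{0}) (gS : S' ⟶ Spec ((Spec (.of (MvPolynomial (Fin n) k ⧸ Ideal.span (Set.range Fs)))).presheaf.stalk v)),
      IsBlowup gS ((affineBlowup.idealSheaf (Ideal.span (Set.range fun j : Fin n => Ideal.Quotient.mk (Ideal.span (Set.range Fs)) (X j)))).comap
        ((Spec (.of (MvPolynomial (Fin n) k ⧸ Ideal.span (Set.range Fs)))).fromSpecStalk v)) →
      ∃ 𝓚 : S'.IdealSheafData, 𝓚 ≠ ⊥ ∧
        (∀ s ∈ (𝓚.support : Set S'), gS.base s = closedPoint ((Spec (.of (MvPolynomial (Fin n) k ⧸ Ideal.span (Set.range Fs)))).presheaf.stalk v)) ∧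
        ∀ (S'' : Scheme.{0}) (π : S'' ⟶ S'), IsBlowup π 𝓚 → ∀ s : S'', FullCl p (S''.presheaf.stalk s) := by
  classical
  obtain ⟨A, KA, t, m, V, a, g, d, hIA, hKprim, hprim, hAJ, hcov, hV, haA, hgen, hge, hθ, hg0, hm⟩ := F108ClassRow.F108Consumable_holds k n (Fs l₀) hconv
  have hex : ∀ (c : Fin t) (l : Fin r), ∃ g' : MvPolynomial (Fin n) k,
      aeval (fun j : Fin n => ∏ i : Fin n, (X i : MvPolynomial (Fin n) k) ^ V c i j) (Fs l) = monomial (d c) 1 * g' ∧ constantCoeff g' ≠ 0 :=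
    fun c l => exists_theta_of_support_eq (V c) (hV c) (Fs l₀) (Fs l) (hsupp l) (d c) (g c) (hθ c) (hg0 c)
  choose gs hgs using hex
  have hv : ∀ c : Fin t, Ideal.Quotient.mk (Ideal.span (Set.range Fs)) (monomial (m c) (1 : k)) ∈
      Ideal.span ((fun e : Fin n →₀ ℕ => Ideal.Quotient.mk (Ideal.span (Set.range Fs)) (monomial e (1 : k))) '' (A : Set (Fin n →₀ ℕ))) :=
    fun c => Ideal.subset_span ⟨m c, hm c, rfl⟩
  exact CIClassRow.fHalfRow_CI_of_tables p k K hn Fs hprime hND hXne hreg A KA (F108ClassRow.span_quotient_eq_mul k _ A KA hIA) hKprim hprim hAJ t m hcov V hV a haA hgen hge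
    gs (fun c _ => d c) (fun c l => (hgs c l).1) (fun c l => (hgs c l).2) hv v hvm

end Summit.ResolutionOfSingularities.ResolutionOfSingularities.Theorems.FInjectiveMacaulayfication.CIClassRowEqualSupport

end
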